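import Literature.NumberTheory.EllipticCurves.CyclotomicIwasawaMainTheoremIrreducibleProofs
import Literature.NumberTheory.EllipticCurves.QuadraticTwistProofs
import Literature.NumberTheory.EllipticCurves.QuadraticTwistKroneckerLFunctionProofs
import Literature.NumberTheory.EllipticCurves.LFunctionPrimeCoeff
import Literature.NumberTheory.EllipticCurves.SerreOpenImageOrdinaryInertiaProofs
import Literature.NumberTheory.EllipticCurves.IwasawaSelmerDualProofs
import HarnessLib

/-!
# bsd.S21′ — "Proof of Theorem 1.1.2" of Burungale–Castella–Skinner, from its displayed inputs

`Proofs` companion (theorems only: no definition, no named fact) of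
`Literature.NumberTheory.EllipticCurves.CyclotomicIwasawaMainTheoremIrreducible`, sequel of
`CyclotomicIwasawaMainTheoremIrreducibleProofs`, for the named fact
`Literature.NumberTheory.EllipticCurves.burungale_castella_skinner_charIdeal_eq_padicLFunction`
(**bsd.S21′**; A. Burungale, F. Castella, C. Skinner, *Base change and Iwasawa main conjectures
for `GL₂`*, Int. Math. Res. Not. IMRN 2025, no. 8, rnaf082 = arXiv:2405.00270v2, Thm. 1.1.2 (a),
p. 2: for `E/ℚ` good ordinary at `p ≥ 5` with `E[p]` irreducible, `X(E/ℚ_∞)` is `Λ`-torsion and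
`ch_Λ X(E/ℚ_∞) = (L_p(E/ℚ))` in `Λ ⊗ ℚ_p`).

## What this file proves

The printed proof (p. 10 of arXiv:2405.00270v2) has exactly two displayed inputs:

* (5.3) `(L_p(g) · L_p(g_K) · L_p(g_F) · L_p(g_{FK})) ⊇ ch X(g) · ch X(g_K) · ch X(g_F) · ch X(g_{FK})`
  in `Λ`, for the newform `g` of `E` and its twists by the quadratic characters of the imaginary
  quadratic field `K`, the real quadratic field `F` (both chosen in Lemma 5.2.3) and of the third
  quadratic subfield of `FK` — the newforms of the quadratic twists `E^{d_K}`, `E^{d_F}`,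
  `E^{d_K d_F}` — obtained from Prop. 5.2.1 (Wan's divisibility over `M = FK`, Thm. 3.2.1, and
  Lemmas 5.1.1–5.1.2) by [CGS23, Prop. 1.2.4] and [SU14, Props. 3.6, 3.9];
* (5.4) `(L_p(h)) ⊆ ch X(h)` in `Λ ⊗ ℚ_p` for each of the four forms `h` [Kat04, Thm. 17.4], the
  tree's named fact `kato_divisibility` (file `PAdicBSD`);

and concludes: "Noting that a proper divisibility in (5.4) would contradict (5.3), the proof
concludes." The previous file proved that sentence as pure algebra
(`exists_span_eq_and_map_eq_C_zpow_mul_of_prod_mem`). THIS file proves the whole paragraph for the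
actual four curves: the main theorem
`burungale_castella_skinner_charIdeal_eq_padicLFunction_of_baseChange_divisibility` derives the
named fact from

1. Kato's theorem `kato_divisibility` for every curve (the tree's named fact, universally closed),
2. the display (5.3) AS PRINTED, transcribed in the tree's vocabulary (hypothesis `h53`; it is the
   base-change half of the theorem and is not a tree fact — Wan's `U(3,1)` Eisenstein congruences,
   Hida theory over CM fields and Skinner–Urban's `Λ`-adic control are not in Mathlib or the tree;
   the transcription is documented on the theorem), and
3. the modularity of elliptic curves over `ℚ` (`exists_isNewformOf`, the tree's named fact), used
   only to attach newforms `g_K, g_F, g_{FK}` to the three twists (classically these are the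
   twisted newforms `g ⊗ χ`; the tree has the twisting operation `charTwist` on cusp forms but not
   yet the identification `IsNewformOf (E^d) (g ⊗ χ_d)` at all `n`),

supplying everything the printed proof leaves implicit about the twists: globally minimal models
of `E^d` exist (`exists_isGloballyMinimal_smul_eq_quadraticTwist`, Néron / Silverman VIII.8.3);
they have good ordinary reduction at `p` when `p ∤ 2d` (`isOrdinaryAt_of_smul_eq_quadraticTwist`:
the twisted equation is minimal at `p` with unit discriminant `d⁶ Δ`, good reduction is an
isomorphism invariant, and `a_p(E^d) = (d/p) a_p(E)` by the tree's
`frobeniusTrace_quadraticTwist_holds`); their Selmer data exist (`selmerDualData`); and the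
four-term case of the algebra (`Fin 4`).

## References

* A. Burungale, F. Castella, C. Skinner, IMRN 2025 (8), rnaf082 = arXiv:2405.00270v2: Thm. 1.1.2
  (p. 2), §5 (pp. 9–10: Prop. 5.2.1, Lemma 5.2.3, "Proof of Theorem 1.1.2", (5.2)–(5.4)).
  [BurungaleCastellaSkinner2025]
* K. Kato, Astérisque 295 (2004), Thm. 17.4. [Kato2004Asterisque]
* J. H. Silverman, *The Arithmetic of Elliptic Curves*, 2nd ed. (2009), VII.1 Prop. 1.3(b) and
  Remark 1.1, VII.5 Prop. 5.1(a), VIII.8 Cor. 8.3, X.5 Cor. 5.4. [SilvermanAEC2009]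
* A. W. Knapp, *Elliptic Curves* (1993), Prop. 12.10 (`a_p` of a twist). [Knapp1993]

## Design

Theorems only, `namespace Literature.NumberTheory.EllipticCurves`. Imports the previous `Proofs`
file, `QuadraticTwistProofs` (twisting formula), `QuadraticTwistKroneckerLFunctionProofs`,
`LFunctionPrimeCoeff` and `SerreOpenImageOrdinaryInertiaProofs` (reduction type of a minimal
equation, the place/prime bridge, `p ∤ Δ_min` at a good prime, global minimal models),
`IwasawaSelmerDualProofs` (existence of the Iwasawa module); the fact's file enters only through
the previous `Proofs` file and nothing in the tree imports this one (no cycle).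
-/

set_option autoImplicit false

noncomputable section

open scoped Classical MatrixGroups ModularForm

open CongruenceSubgroup WeierstrassCurve IsDedekindDomain NumberField Rat.HeightOneSpectrum
  Literature.NumberTheory.EllipticCurves.ModularForms

namespace Literature.NumberTheory.EllipticCurves

/-! ### Quadratic twists: minimal models, good ordinary reduction -/

section Twists

/-- **Global minimal models of a quadratic twist** (Néron 1964; Silverman, *AEC* VIII.8,
Cor. 8.3: every elliptic curve over `ℚ` has a global minimal Weierstrass equation). For `d ≠ 0`
there is a globally minimal `W'/ℚ` that is `ℚ`-isomorphic to `W.quadraticTwist d`, in the shape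
`∃ C, C • W' = W.quadraticTwist d` used by `frobeniusTrace_quadraticTwist`.
[cite: SilvermanAEC2009, VIII.8 Cor. 8.3] -/
theorem exists_isGloballyMinimal_smul_eq_quadraticTwist (W : WeierstrassCurve ℚ) [W.IsElliptic]
    {d : ℚ} (hd : d ≠ 0) :
    ∃ (W' : WeierstrassCurve ℚ) (_ : W'.IsElliptic) (_ : W'.IsGloballyMinimal)
      (C : VariableChange ℚ), C • W' = W.quadraticTwist d := by
  haveI := W.isElliptic_quadraticTwist hd
  obtain ⟨C, hC⟩ := hasGlobalMinimalModel_rat_holds (W.quadraticTwist d)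
  exact ⟨C • W.quadraticTwist d, inferInstance, hC, C⁻¹, inv_smul_smul C _⟩

/-- **A globally minimal model of the twist `E^d` is good ordinary at every good ordinary prime
`p ∤ 2d` of `E`.** Let `W, W'/ℚ` be globally minimal, `W` elliptic, `C • W' = W.quadraticTwist d`
with `d` squarefree, and `p ∤ 2d` a prime at which `W` is good ordinary. Then `W'` is good
ordinary at `p`: the twisted equation has `v`-integral coefficients `d b₂/4, d² b₄/2, d³ b₆/4` and
`v`-unit discriminant `d⁶ Δ_W` at the place `v` over `p`, hence is minimal at `v` with good
reduction (Silverman, *AEC* VII.1 Remark 1.1, VII.5 Prop. 5.1(a)); good reduction is an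
isomorphism invariant (`hasGoodReductionAt_smul_iff_holds`); and `a_p(W') = (d/p) · a_p(W)` with
`(d/p) = ±1` (`frobeniusTrace_quadraticTwist_holds`; Knapp, *Elliptic Curves*, Prop. 12.10).
[cite: Knapp1993, Prop. 12.10] -/
theorem isOrdinaryAt_of_smul_eq_quadraticTwist (W W' : WeierstrassCurve ℚ) [W.IsElliptic]
    [W.IsGloballyMinimal] [W'.IsGloballyMinimal] {d : ℤ} (hd : Squarefree d)
    {C : VariableChange ℚ} (hC : C • W' = W.quadraticTwist (d : ℚ)) (p : ℕ) [Fact p.Prime]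
    (hp2 : p ≠ 2) (hpd : ¬ (p : ℤ) ∣ d) (hW : IsOrdinaryAt W p) : IsOrdinaryAt W' p := by
  obtain ⟨hgood, hord⟩ := hW
  have hpP : p.Prime := Fact.out
  have hpZ : Prime (p : ℤ) := Nat.prime_iff_prime_int.mp hpP
  have hp2' : ¬ (p : ℤ) ∣ 2 := fun h =>
    hp2 ((Nat.prime_dvd_prime_iff_eq hpP Nat.prime_two).mp (Int.natCast_dvd_natCast.mp h))
  have hp2d : ¬ (p : ℤ) ∣ 2 * d := fun h => (hpZ.dvd_or_dvd h).elim hp2' hpd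
  have hΔmin : ¬ (p : ℤ) ∣ W.minimalDiscriminantInt :=
    W.not_dvd_minimalDiscriminantInt_of_hasGoodReductionAtPrime' p hgood
  refine ⟨?_, ?_⟩
  · -- good reduction of `W'` at `p`, through the place `v` over `p`
    obtain ⟨v, rfl⟩ : ∃ v : HeightOneSpectrum (𝓞 ℚ), ((primesEquiv v : ℕ)) = p :=
      ⟨primesEquiv.symm ⟨p, Fact.out⟩, by rw [Equiv.apply_symm_apply]⟩
    have hp4 : ¬ ((primesEquiv v : ℕ) : ℤ) ∣ 4 := fun h =>
      (hpZ.dvd_or_dvd (show ((primesEquiv v : ℕ) : ℤ) ∣ 2 * 2 by norm_num; exact h)).elim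
        hp2' hp2'
    -- integrality of the coefficients of `W`
    set M : WeierstrassCurve ℤ := integralModelInt W with hM
    have hWM : M.map (Int.castRingHom ℚ) = W := map_integralModelInt W
    have hWb₂ : W.b₂ = (M.b₂ : ℚ) := by
      rw [← congrArg WeierstrassCurve.b₂ hWM, map_b₂, eq_intCast]
    have hWb₄ : W.b₄ = (M.b₄ : ℚ) := by
      rw [← congrArg WeierstrassCurve.b₄ hWM, map_b₄, eq_intCast]
    have hWb₆ : W.b₆ = (M.b₆ : ℚ) := by
      rw [← congrArg WeierstrassCurve.b₆ hWM, map_b₆, eq_intCast]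
    -- valuations at `v`
    have hv4 : v.valuation ℚ (4 : ℚ) = 1 := by
      have h := valuation_ringOfIntegers_intCast_eq_one v (n := 4) (by exact_mod_cast hp4)
      simpa using h
    have hv2 : v.valuation ℚ (2 : ℚ) = 1 := by
      have h := valuation_ringOfIntegers_intCast_eq_one v (n := 2) (by exact_mod_cast hp2')
      simpa using h
    have hvd : v.valuation ℚ (d : ℚ) = 1 := valuation_ringOfIntegers_intCast_eq_one v hpd
    have hvΔ : v.valuation ℚ W.Δ = 1 := by
      rw [← cast_minimalDiscriminantInt]
      exact valuation_ringOfIntegers_intCast_eq_one v hΔmin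
    have hvb₂ : v.valuation ℚ W.b₂ ≤ 1 := hWb₂ ▸ valuation_ringOfIntegers_intCast_le_one v _
    have hvb₄ : v.valuation ℚ W.b₄ ≤ 1 := hWb₄ ▸ valuation_ringOfIntegers_intCast_le_one v _
    have hvb₆ : v.valuation ℚ W.b₆ ≤ 1 := hWb₆ ▸ valuation_ringOfIntegers_intCast_le_one v _
    -- the twisted equation is minimal at `v` with unit discriminant, hence good at `v`
    set X : WeierstrassCurve ℚ := W.quadraticTwist (d : ℚ) with hXdef
    have hXmin : X.IsMinimalAt v := by
      refine isMinimalAt_of_valuation X v ?_ ?_ ?_ ?_ ?_ ?_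
      · simp [hXdef]
      · simp only [hXdef, quadraticTwist_a₂, map_div₀, map_mul, hv4, hvd, div_one, one_mul]
        exact hvb₂
      · simp [hXdef]
      · simp only [hXdef, quadraticTwist_a₄, map_div₀, map_mul, map_pow, hv2, hvd, div_one,
          one_mul, one_pow]
        exact hvb₄
      · simp only [hXdef, quadraticTwist_a₆, map_div₀, map_mul, map_pow, hv4, hvd, div_one,
          one_mul, one_pow]
        exact hvb₆
      · simp only [hXdef, quadraticTwist_Δ, map_mul, map_pow, hvd, one_pow, one_mul, hvΔ]
    have hXgood : X.HasGoodReductionAt v := by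
      rw [hasGoodReductionAt_iff_of_isMinimalAt hXmin]
      simp only [hXdef, quadraticTwist_Δ, map_mul, map_pow, hvd, one_pow, one_mul, hvΔ]
    have hW'good : W'.HasGoodReductionAt v := by
      rw [← hasGoodReductionAt_smul_iff_holds v W' C, hC]
      exact hXgood
    exact (hasGoodReductionAtPrime_iff_hasGoodReductionAt_ringOfIntegers v W').mpr hW'good
  · -- `a_p(W') = (d/p) a_p(W)` with `(d/p) = ±1`
    rw [frobeniusTrace_quadraticTwist_holds W W' d hd ⟨C, hC⟩ p hp2d hΔmin]
    have hd0 : ((d : ℤ) : ZMod p) ≠ 0 := by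
      rwa [Ne, ZMod.intCast_zmod_eq_zero_iff_dvd]
    rcases legendreSym.eq_one_or_neg_one p hd0 with h1 | h1 <;> rw [h1]
    · simpa using hord
    · simpa using hord

end Twists

/-! ### Generators of characteristic ideals -/

section CharIdeal

variable (p : ℕ) [Fact p.Prime] {W : WeierstrassCurve ℚ} {κ : ZpExtension ℚ p}
  {γ : Field.absoluteGaloisGroup ℚ}

/-- The characteristic ideal of the Iwasawa module of a Pontryagin-dual datum is principal
(`charIdeal_isPrincipal_holds`, `Λ = ℤ_p⟦T⟧` a UFD) and nonzero (`Module.charIdeal_ne_bot`):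
`ch X = (c)` with `c ≠ 0` (Washington, *Introduction to Cyclotomic Fields*, §13.2).
[folklore] -/
theorem exists_charIdeal_eq_span_singleton (D : W.SelmerDualData κ γ) :
    ∃ c : IwasawaAlgebra p, D.charIdeal = Ideal.span {c} ∧ c ≠ 0 := by
  haveI : (Module.charIdeal (IwasawaAlgebra p) D.X).IsPrincipal := charIdeal_isPrincipal_holds p D.X
  obtain ⟨c, hc⟩ := Submodule.IsPrincipal.principal (Module.charIdeal (IwasawaAlgebra p) D.X)
  refine ⟨c, hc, fun h0 => Module.charIdeal_ne_bot (IwasawaAlgebra p) D.X ?_⟩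
  rw [hc, h0]
  exact Ideal.span_singleton_eq_bot.mpr rfl

end CharIdeal

/-! ### Thm. 1.1.2 (a) from (5.3), (5.4) = Kato, and modularity of the twists -/

/-- **Burungale–Castella–Skinner, Thm. 1.1.2 (a), from the displayed inputs of its printed proof**
("Proof of Theorem 1.1.2", p. 10 of arXiv:2405.00270v2). Assume:
* `hkato` — Kato's theorem for every elliptic curve over `ℚ` (the tree's named fact
  `kato_divisibility`, Kato 2004, Thm. 17.4 = display (5.4) of the source: `X(h/ℚ_∞)` is
  `Λ`-torsion and `(L_p(h)) ⊆ ch X(h)` in `Λ ⊗ ℚ_p`);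
* `hmod` — modularity of elliptic curves over `ℚ` (the tree's named fact `exists_isNewformOf`),
  used to attach newforms to the three quadratic twists (classically the twisted newforms
  `g ⊗ χ`);
* `h53` — **display (5.3) of the source, as printed** (from Prop. 5.2.1 — Wan's divisibility,
  Thm. 3.2.1, over `M = FK`, with Lemmas 5.1.1–5.1.2 — for the fields `K`, `F` of Lemma 5.2.3,
  then [CGS23, Prop. 1.2.4] and [SU14, Props. 3.6, 3.9]), transcribed in the tree's vocabulary:
  for `E/ℚ` (globally minimal `W`), `p ≥ 5` good ordinary, `E[p]` irreducible, `κ, γ` cyclotomic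
  as in the named fact and `f = g` the newform of `E` of level `N`, there are integers `d_K < 0`,
  `d_F > 1`, squarefree and `≡ 1 (mod 4)`, `d_K ≠ -3`, `(d_K, d_F) = 1`, `(d_K d_F, pN) = 1`,
  `d_K` a square and `d_F` a non-square mod `p` (the fields `K = ℚ(√d_K)`, `F = ℚ(√d_F)` of
  Lemma 5.2.3: (disc), (Heeg), (spl); `p` inert in `F`, `D_F` odd, prime to `D_K`, unramified
  at `N` — the Galois-theoretic conditions (irr_K), (irr_M), (v) have no tree vocabulary and are
  not recorded, which only weakens the hypothesis' content but not its use here), such that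
  for all globally minimal models `W₁, W₂, W₃` of the twists of `E` by `d_K, d_F, d_K d_F`
  (`∃ C, C • Wᵢ = W.quadraticTwist d`), their newforms `f₁ = g_K, f₂ = g_F, f₃ = g_{FK}` and
  Pontryagin-dual data `D, D₁, D₂, D₃` over `(κ, γ)`:
  `(L_p(g) L_p(g_K) L_p(g_F) L_p(g_{FK})) ⊇ ch X(g) · ch X(g_K) · ch X(g_F) · ch X(g_{FK})`, in
  `Λ ⊗ ℚ_p` (printed in `Λ_K⁺ ≃ Λ`; spelled with explicit powers of `p` as in `PAdicBSD`:
  `ι G = p^n ∏ L_p`, `p^m ∏ ch ⊆ (G)`, which the printed integral inclusion implies for any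
  normalisation of the four `p`-adic `L`-functions by constants in `ℚ_pˣ`, in particular for
  `padicLFunction fᵢ (unitRoot Wᵢ p)`).
Then the named fact `burungale_castella_skinner_charIdeal_eq_padicLFunction` holds. Proof, as
printed: pick `d_K, d_F` by `h53`; take globally minimal models of the three twists
(`exists_isGloballyMinimal_smul_eq_quadraticTwist`), which are good ordinary at `p` since
`p ∤ 2 d_K d_F` (`isOrdinaryAt_of_smul_eq_quadraticTwist`), their newforms (`hmod`) and Selmer
data (`selmerDualData`); apply (5.4) = `hkato` to each of the four curves and (5.3) = `h53`; "a
proper divisibility in (5.4) would contradict (5.3)" is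
`exists_span_eq_and_map_eq_C_zpow_mul_of_prod_mem` over `Fin 4` at the index of `E`.
[cite: BurungaleCastellaSkinner2025, Thm. 1.1.2 (a) and its proof, display (5.3) (pp. 2, 10 of arXiv:2405.00270v2)] -/
theorem burungale_castella_skinner_charIdeal_eq_padicLFunction_of_baseChange_divisibility
    (hkato : ∀ (W : WeierstrassCurve ℚ) [W.IsElliptic] [W.IsGloballyMinimal] (p : ℕ) [Fact p.Prime]
      (κ : ZpExtension ℚ p) (γ : Field.absoluteGaloisGroup ℚ) (N : ℕ) [NeZero N]
      (f : CuspForm (Gamma0 N) 2), kato_divisibility W p (κ := κ) (γ := γ) (f := f))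
    (hmod : exists_isNewformOf)
    (h53 : ∀ (W : WeierstrassCurve ℚ) [W.IsElliptic] [W.IsGloballyMinimal] (p : ℕ) [Fact p.Prime]
      (κ : ZpExtension ℚ p) (γ : Field.absoluteGaloisGroup ℚ) {N : ℕ} [NeZero N]
      (f : CuspForm (Gamma0 N) 2)
      (hp : 5 ≤ p) (hgood : W.HasGoodReductionAtPrime p) (hord : ¬ (p : ℤ) ∣ W.frobeniusTrace p)
      (hirr : W.HasIrreducibleModPGaloisRep p) (hκ : κ.IsCyclotomic) (hγ : κ.IsTopGenerator γ)
      (hγ' : IsCyclotomicVariable p γ) (hf : IsNewformOf W f),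
      ∃ dK dF : ℤ,
        dK < 0 ∧ dK % 4 = 1 ∧ Squarefree dK ∧ dK ≠ -3 ∧
        1 < dF ∧ dF % 4 = 1 ∧ Squarefree dF ∧ IsCoprime dK dF ∧
        IsCoprime (dK * dF) (p * N) ∧
        IsSquare ((dK : ZMod p)) ∧ ¬ IsSquare ((dF : ZMod p)) ∧
        ∀ (W₁ W₂ W₃ : WeierstrassCurve ℚ) [W₁.IsElliptic] [W₁.IsGloballyMinimal]
          [W₂.IsElliptic] [W₂.IsGloballyMinimal] [W₃.IsElliptic] [W₃.IsGloballyMinimal]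
          (h₁ : ∃ C : VariableChange ℚ, C • W₁ = W.quadraticTwist (dK : ℚ))
          (h₂ : ∃ C : VariableChange ℚ, C • W₂ = W.quadraticTwist (dF : ℚ))
          (h₃ : ∃ C : VariableChange ℚ, C • W₃ = W.quadraticTwist ((dK * dF : ℤ) : ℚ))
          {N₁ N₂ N₃ : ℕ} [NeZero N₁] [NeZero N₂] [NeZero N₃]
          (f₁ : CuspForm (Gamma0 N₁) 2) (f₂ : CuspForm (Gamma0 N₂) 2)
          (f₃ : CuspForm (Gamma0 N₃) 2)
          (hf₁ : IsNewformOf W₁ f₁) (hf₂ : IsNewformOf W₂ f₂) (hf₃ : IsNewformOf W₃ f₃)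
          (D : W.SelmerDualData κ γ) (D₁ : W₁.SelmerDualData κ γ) (D₂ : W₂.SelmerDualData κ γ)
          (D₃ : W₃.SelmerDualData κ γ),
          ∃ (m n : ℕ) (G : IwasawaAlgebra p),
            iwasawaToPowerSeries p G =
                PowerSeries.C ((p : ℚ_[p]) ^ n) *
                  (padicLFunction f (unitRoot W p : ℚ_[p]) *
                    padicLFunction f₁ (unitRoot W₁ p : ℚ_[p]) *
                    padicLFunction f₂ (unitRoot W₂ p : ℚ_[p]) *
                    padicLFunction f₃ (unitRoot W₃ p : ℚ_[p])) ∧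
              Ideal.span {PowerSeries.C ((p : ℤ_[p]) ^ m)} *
                  (D.charIdeal * D₁.charIdeal * D₂.charIdeal * D₃.charIdeal) ≤
                Ideal.span {G}) :
    burungale_castella_skinner_charIdeal_eq_padicLFunction := by
  intro W _ _ p _ κ γ N _ f hp hgood hord hirr hκ hγ hγ' hf D
  have hp2 : p ≠ 2 := by omega
  have hpP : p.Prime := Fact.out
  have hpZ : Prime (p : ℤ) := Nat.prime_iff_prime_int.mp hpP
  obtain ⟨dK, dF, hK0, -, hKsq, -, hF1, -, hFsq, hKF, hcop, -, -, H⟩ :=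
    h53 W p κ γ f hp hgood hord hirr hκ hγ hγ' hf
  -- `p ∤ d_K`, `p ∤ d_F`, `p ∤ d_K d_F`
  have hpunit : ¬ IsUnit (p : ℤ) := by
    rw [Int.isUnit_iff_natAbs_eq, Int.natAbs_natCast]
    exact hpP.one_lt.ne'
  have hpK : ¬ (p : ℤ) ∣ dK := fun h =>
    hpunit (hcop.isUnit_of_dvd' (dvd_mul_of_dvd_left h _) (dvd_mul_right _ _))
  have hpF : ¬ (p : ℤ) ∣ dF := fun h =>
    hpunit (hcop.isUnit_of_dvd' (dvd_mul_of_dvd_right h _) (dvd_mul_right _ _))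
  have hpKF : ¬ (p : ℤ) ∣ dK * dF := fun h => (hpZ.dvd_or_dvd h).elim hpK hpF
  have hKFsq : Squarefree (dK * dF) := squarefree_mul_iff.mpr ⟨hKF.isRelPrime, hKsq, hFsq⟩
  have hF0 : dF ≠ 0 := by omega
  have hK0' : (dK : ℚ) ≠ 0 := by exact_mod_cast hK0.ne
  have hF0' : (dF : ℚ) ≠ 0 := by exact_mod_cast hF0
  have hKF0' : ((dK * dF : ℤ) : ℚ) ≠ 0 := by exact_mod_cast mul_ne_zero hK0.ne hF0
  -- globally minimal models of the three twists, good ordinary at `p`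
  obtain ⟨W₁, hE₁, hM₁, C₁, hC₁⟩ := exists_isGloballyMinimal_smul_eq_quadraticTwist W hK0'
  obtain ⟨W₂, hE₂, hM₂, C₂, hC₂⟩ := exists_isGloballyMinimal_smul_eq_quadraticTwist W hF0'
  obtain ⟨W₃, hE₃, hM₃, C₃, hC₃⟩ := exists_isGloballyMinimal_smul_eq_quadraticTwist W hKF0'
  have hW : IsOrdinaryAt W p := ⟨hgood, hord⟩
  have hord₁ : IsOrdinaryAt W₁ p := isOrdinaryAt_of_smul_eq_quadraticTwist W W₁ hKsq hC₁ p hp2 hpK hW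
  have hord₂ : IsOrdinaryAt W₂ p := isOrdinaryAt_of_smul_eq_quadraticTwist W W₂ hFsq hC₂ p hp2 hpF hW
  have hord₃ : IsOrdinaryAt W₃ p :=
    isOrdinaryAt_of_smul_eq_quadraticTwist W W₃ hKFsq hC₃ p hp2 hpKF hW
  -- their newforms (modularity) and Selmer data
  have hN₁ : 0 < W₁.conductorNorm ℤ := conductorNorm_pos_holds W₁
  have hN₂ : 0 < W₂.conductorNorm ℤ := conductorNorm_pos_holds W₂
  have hN₃ : 0 < W₃.conductorNorm ℤ := conductorNorm_pos_holds W₃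
  haveI : NeZero (W₁.conductorNorm ℤ) := ⟨hN₁.ne'⟩
  haveI : NeZero (W₂.conductorNorm ℤ) := ⟨hN₂.ne'⟩
  haveI : NeZero (W₃.conductorNorm ℤ) := ⟨hN₃.ne'⟩
  obtain ⟨f₁, hf₁⟩ := hmod W₁
  obtain ⟨f₂, hf₂⟩ := hmod W₂
  obtain ⟨f₃, hf₃⟩ := hmod W₃
  set D₁ : W₁.SelmerDualData κ γ := W₁.selmerDualData κ hγ with hD₁
  set D₂ : W₂.SelmerDualData κ γ := W₂.selmerDualData κ hγ with hD₂
  set D₃ : W₃.SelmerDualData κ γ := W₃.selmerDualData κ hγ with hD₃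
  -- (5.3)
  obtain ⟨m, n, G, hιG, hG⟩ :=
    H W₁ W₂ W₃ ⟨C₁, hC₁⟩ ⟨C₂, hC₂⟩ ⟨C₃, hC₃⟩ f₁ f₂ f₃ hf₁ hf₂ hf₃ D D₁ D₂ D₃
  -- (5.4) for the four curves
  obtain ⟨ht₀, ⟨a₀, k₀, hk₀, hι₀⟩, -⟩ := hkato W p κ γ N f hp2 hW hκ hγ hγ' hf D
  obtain ⟨-, ⟨a₁, k₁, hk₁, hι₁⟩, -⟩ := hkato W₁ p κ γ _ f₁ hp2 hord₁ hκ hγ hγ' hf₁ D₁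
  obtain ⟨-, ⟨a₂, k₂, hk₂, hι₂⟩, -⟩ := hkato W₂ p κ γ _ f₂ hp2 hord₂ hκ hγ hγ' hf₂ D₂
  obtain ⟨-, ⟨a₃, k₃, hk₃, hι₃⟩, -⟩ := hkato W₃ p κ γ _ f₃ hp2 hord₃ hκ hγ hγ' hf₃ D₃
  -- generators of the four characteristic ideals
  obtain ⟨c₀, hc₀, hc₀0⟩ := exists_charIdeal_eq_span_singleton p D
  obtain ⟨c₁, hc₁, hc₁0⟩ := exists_charIdeal_eq_span_singleton p D₁
  obtain ⟨c₂, hc₂, hc₂0⟩ := exists_charIdeal_eq_span_singleton p D₂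
  obtain ⟨c₃, hc₃, hc₃0⟩ := exists_charIdeal_eq_span_singleton p D₃
  rw [hc₀] at hk₀
  rw [hc₁] at hk₁
  rw [hc₂] at hk₂
  rw [hc₃] at hk₃
  -- "a proper divisibility in (5.4) would contradict (5.3)": the algebra over `Fin 4`
  set g : Fin 4 → IwasawaAlgebra p := ![c₀, c₁, c₂, c₃] with hgdef
  set g₁ : Fin 4 → IwasawaAlgebra p := ![k₀, k₁, k₂, k₃] with hg₁def
  set L : Fin 4 → PowerSeries ℚ_[p] :=
    ![padicLFunction f (unitRoot W p : ℚ_[p]), padicLFunction f₁ (unitRoot W₁ p : ℚ_[p]),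
      padicLFunction f₂ (unitRoot W₂ p : ℚ_[p]), padicLFunction f₃ (unitRoot W₃ p : ℚ_[p])]
    with hLdef
  set a : Fin 4 → ℕ := ![a₀, a₁, a₂, a₃] with hadef
  have hg0 : ∀ i ∈ (Finset.univ : Finset (Fin 4)), g i ≠ 0 := by
    intro i _
    fin_cases i
    · simpa [hgdef] using hc₀0
    · simpa [hgdef] using hc₁0
    · simpa [hgdef] using hc₂0
    · simpa [hgdef] using hc₃0
  have hgg₁ : ∀ i ∈ (Finset.univ : Finset (Fin 4)), g₁ i ∈ Ideal.span {g i} := by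
    intro i _
    fin_cases i
    · simpa [hgdef, hg₁def] using hk₀
    · simpa [hgdef, hg₁def] using hk₁
    · simpa [hgdef, hg₁def] using hk₂
    · simpa [hgdef, hg₁def] using hk₃
  have hιg₁ : ∀ i ∈ (Finset.univ : Finset (Fin 4)),
      iwasawaToPowerSeries p (g₁ i) = PowerSeries.C ((p : ℚ_[p]) ^ a i) * L i := by
    intro i _
    fin_cases i
    · simpa [hg₁def, hLdef, hadef] using hι₀
    · simpa [hg₁def, hLdef, hadef] using hι₁
    · simpa [hg₁def, hLdef, hadef] using hι₂
    · simpa [hg₁def, hLdef, hadef] using hι₃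
  have hprodg : ∏ i ∈ (Finset.univ : Finset (Fin 4)), g i = c₀ * c₁ * c₂ * c₃ := by
    rw [Fin.prod_univ_four]
    simp [hgdef]
  have hprodL : ∏ i ∈ (Finset.univ : Finset (Fin 4)), L i =
      padicLFunction f (unitRoot W p : ℚ_[p]) * padicLFunction f₁ (unitRoot W₁ p : ℚ_[p]) *
        padicLFunction f₂ (unitRoot W₂ p : ℚ_[p]) * padicLFunction f₃ (unitRoot W₃ p : ℚ_[p]) := by
    rw [Fin.prod_univ_four]
    simp [hLdef]
  have hGmem : PowerSeries.C ((p : ℤ_[p]) ^ m) * ∏ i ∈ (Finset.univ : Finset (Fin 4)), g i ∈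
      Ideal.span {G} := by
    rw [hprodg]
    refine hG (Ideal.mul_mem_mul (Ideal.mem_span_singleton_self _) ?_)
    refine Ideal.mul_mem_mul (Ideal.mul_mem_mul (Ideal.mul_mem_mul ?_ ?_) ?_) ?_
    · rw [hc₀]; exact Ideal.mem_span_singleton_self _
    · rw [hc₁]; exact Ideal.mem_span_singleton_self _
    · rw [hc₂]; exact Ideal.mem_span_singleton_self _
    · rw [hc₃]; exact Ideal.mem_span_singleton_self _
  have hιG' : iwasawaToPowerSeries p G =
      PowerSeries.C ((p : ℚ_[p]) ^ n) * ∏ i ∈ (Finset.univ : Finset (Fin 4)), L i := by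
    rw [hprodL, hιG]
  obtain ⟨g', k, hspan, hι⟩ := exists_span_eq_and_map_eq_C_zpow_mul_of_prod_mem p hg0 hgg₁ hιg₁
    hGmem hιG' (i := 0) (Finset.mem_univ _)
  refine ⟨ht₀, g', k, ?_, ?_⟩
  · rw [hc₀, ← hspan]
    simp [hgdef]
  · rw [hι]
    simp [hLdef]

end Literature.NumberTheory.EllipticCurves

end
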